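import Summits.AnomalousDissipation.AnomalousDissipation.Theses.KolmogorovPincer
import Summits.AnomalousDissipation.AnomalousDissipation.Theorems.KolmogorovPincerBesovSignalMeasurableTG
import Summits.AnomalousDissipation.AnomalousDissipation.Theorems.KolmogorovPincerLagSignalMeasurableTG
import Literature.Analysis.FluidPDE.AlexakisDoeringInterpolation
import Literature.Analysis.FluidPDE.LongTimeAverageNonneg
import Literature.Analysis.FluidPDE.LongTimeAverageSubadditive
import Literature.Analysis.FunctionSpaces.BesovDifference
import Literature.Analysis.FunctionSpaces.FlatTorus

/-!
# Glue item `KolmogorovPincer.LagCutGlue` (stmt-AnomalousDissipation-33460), proved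

Route `KolmogorovPincer` (decomp-ad cell), the KOLMOGOROV LAG CUT of the Y-jaw: the parent crux
`KolmogorovCeilingTG` (32240) was SPLIT (gen 1) into `SubKolmogorovCeilingTG` (33458, quotient sup over the
dissipation-range lags `‖h‖ < ν^{3/4}`) and `TaylorRangeCeilingTG` (33459, lags `‖h‖ > ν^{3/4}/2`) with the
glue `LagCutGlue := SubKolmogorovCeilingTG → TaylorRangeCeilingTG → KolmogorovCeilingTG`.  The two lag
ranges are an open OVERLAPPING COVER of `{h ≠ 0}`, so at every time slice the full Nikol'skii sup is the
max of the two restricted sups (`eBesovSupSeminorm_eq_max_lags`) and `[v]² ≤ [v]²_diss + [v]²_inert`;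
clause (a) re-adds as `max < ⊤`, clause (b) by domination `Y ≤ Y_diss + Y_inert` a.e. on `(0,T]` with the
measurability of the FULL signal supplied by the closed item `BesovSignalMeasurableTG` (32778, entering BY
NAME through the landed `KolmogorovPincerBesovSignalMeasurableTG.kolmogorovPincer_besovSignalMeasurableTG`),
clause (c) by additivity / monotonicity of the running means (tree `timeMean_add`, `timeMean_nonneg`):
`M = M₁ + M₂`, `ν₀ = min`, `T₀ = max(T₁, T₂, 1)`.  The restricted sup `eBesovSupOn` and the lag sets are
those of `Theorems/KolmogorovPincerLagSignalMeasurableTG.lean` (item 33461); the tree texts of 33458 / 33459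
are their unfoldings (definitional).
Ported verbatim (by name against the route file, rev 11) from the decomp-ad lens-1 g15 node file
`KolmogorovLagCut.lean` v2 (`kolmogorovCeilingTG_of_lagCut`, `lagCutGlue_holds`, kernel-checked there
2026-08-30, crit «CLEARED»; the converse WEAKER certificates `KolmogorovCeilingTG → each half` and the
exactness `KolmogorovCeilingTG ↔ Sub ∧ Taylor` stay in the node file); landed by the cell's prover seat.
Nothing here proves the summit, the jaw or either half. References: Frisch 1995 §7.1, §8.5.5. [folklore]
-/

set_option linter.dupNamespace false

noncomputable section

namespace Summit.AnomalousDissipation.AnomalousDissipation.Theorems.KolmogorovPincerLagCutGlue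

open scoped BigOperators Topology Classical MeasureTheory InnerProductSpace
open Filter Set Function TopologicalSpace MeasureTheory
open scoped ENNReal
open Literature.Analysis.FunctionSpaces Literature.Analysis.FluidPDE
open Summit.AnomalousDissipation.AnomalousDissipation.Theses
open Summit.AnomalousDissipation.AnomalousDissipation.Theses.KolmogorovPincer
open Summit.AnomalousDissipation.AnomalousDissipation.Theorems.KolmogorovPincerLagSignalMeasurableTG

section CoverAlgebra

variable {s : ℝ} {p : ℝ≥0∞} {v : UnitAddTorus (Fin 3) → EuclideanSpace ℝ (Fin 3)}
  {S S₁ S₂ : Set (UnitAddTorus (Fin 3))}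

/-- The two lag ranges cover all lags (they overlap on the octave `ν^{3/4}/2 < ‖h‖ < ν^{3/4}`). -/
theorem lags_cover {ν : ℝ} (hν : 0 < ν) (h : UnitAddTorus (Fin 3)) :
    h ∈ dissLags ν ∨ h ∈ inertLags ν := by
  by_cases hh : ‖h‖ < ν ^ (3 / 4 : ℝ)
  · exact Or.inl hh
  · right
    have hr : 0 < ν ^ (3 / 4 : ℝ) := Real.rpow_pos_of_pos hν _
    show ν ^ (3 / 4 : ℝ) / 2 < ‖h‖
    linarith [not_lt.1 hh]

/-- A restricted sup is below the full Nikol'skii–Besov sup-seminorm. -/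
theorem eBesovSupOn_le_eBesovSupSeminorm : eBesovSupOn s p v S ≤ eBesovSupSeminorm s p v volume :=
  iSup₂_le fun _ hh => iSup_le fun _ => eDiffQuotient_le_eBesovSupSeminorm hh

/-- A sup over a cover by two lag sets is the max of the two restricted sups (upper bound). -/
theorem eBesovSupSeminorm_le_max_of_cover (hcov : ∀ h : UnitAddTorus (Fin 3), h ≠ 0 → h ∈ S₁ ∨ h ∈ S₂) :
    eBesovSupSeminorm s p v volume ≤ max (eBesovSupOn s p v S₁) (eBesovSupOn s p v S₂) := by
  simp only [eBesovSupSeminorm]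
  refine iSup₂_le fun h hh => ?_
  rcases hcov h hh with h1 | h2
  · exact (eDiffQuotient_le_eBesovSupOn hh h1).trans (le_max_left _ _)
  · exact (eDiffQuotient_le_eBesovSupOn hh h2).trans (le_max_right _ _)

/-- EXACTNESS at the level of a time slice: `[v] = max([v]_diss, [v]_inert)`. -/
theorem eBesovSupSeminorm_eq_max_lags {ν : ℝ} (hν : 0 < ν) :
    eBesovSupSeminorm s p v volume =
      max (eBesovSupOn s p v (dissLags ν)) (eBesovSupOn s p v (inertLags ν)) :=
  le_antisymm (eBesovSupSeminorm_le_max_of_cover fun h _ => lags_cover hν h)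
    (max_le eBesovSupOn_le_eBesovSupSeminorm eBesovSupOn_le_eBesovSupSeminorm)

/-- `[v]² ≤ [v]²_diss + [v]²_inert` (ENNReal). -/
theorem eBesovSupSeminorm_sq_le_add {ν : ℝ} (hν : 0 < ν) :
    eBesovSupSeminorm s p v volume ^ 2 ≤
      eBesovSupOn s p v (dissLags ν) ^ 2 + eBesovSupOn s p v (inertLags ν) ^ 2 := by
  rw [eBesovSupSeminorm_eq_max_lags hν]
  rcases le_total (eBesovSupOn s p v (dissLags ν)) (eBesovSupOn s p v (inertLags ν)) with h | h
  · rw [max_eq_right h]; exact le_add_self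
  · rw [max_eq_left h]; exact le_self_add

end CoverAlgebra

section Glue

/-- **Route decl `KolmogorovPincer.LagCutGlue` (stmt-AnomalousDissipation-33460), proved**: the glue of the
gen-1 split of `KolmogorovCeilingTG` — the two halves give back the Y-jaw with `M = M₁ + M₂`,
`ν₀ = min ν₁ ν₂`, `T₀ = max (max T₁ T₂) 1`; the measurability of the FULL signal (clause (b)) is the closed
item `BesovSignalMeasurableTG`, discharged BY NAME through the landed
`kolmogorovPincer_besovSignalMeasurableTG` (item 32778).  (One theorem whose type is the item decl itself:
the node's `kolmogorovCeilingTG_of_lagCut` is inlined so that no declaration of this file has the parent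
crux `KolmogorovCeilingTG` as its conclusion.) [folklore] -/
theorem kolmogorovPincer_lagCutGlue : KolmogorovPincer.LagCutGlue := by
  intro hD hI
  have hS : BesovSignalMeasurableTG :=
    KolmogorovPincerBesovSignalMeasurableTG.kolmogorovPincer_besovSignalMeasurableTG
  intro f hf
  obtain ⟨M₁, ν₁, hν₁, h1⟩ := hD f hf
  obtain ⟨M₂, ν₂, hν₂, h2⟩ := hI f hf
  refine ⟨M₁ + M₂, min ν₁ ν₂, lt_min hν₁ hν₂, ?_⟩
  intro ν hν hνlt u hu
  obtain ⟨a1, b1, T₁, c1⟩ := h1 ν hν (lt_of_lt_of_le hνlt (min_le_left _ _)) u hu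
  obtain ⟨a2, b2, T₂, c2⟩ := h2 ν hν (lt_of_lt_of_le hνlt (min_le_right _ _)) u hu
  -- names
  set d : ℝ → ℝ≥0∞ := fun t => eBesovSupOn (1 / 2 : ℝ) (8 / 3 : ENNReal) (u t) (dissLags ν) with hd
  set i : ℝ → ℝ≥0∞ := fun t => eBesovSupOn (1 / 2 : ℝ) (8 / 3 : ENNReal) (u t) (inertLags ν) with hi
  set Y : ℝ → ℝ := fun t => ν ^ (1 / 4 : ℝ) *
    ((eBesovSupSeminorm (1 / 2 : ℝ) (8 / 3 : ENNReal) (u t) volume) ^ 2).toReal with hYdef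
  set Yd : ℝ → ℝ := fun t => ν ^ (1 / 4 : ℝ) * ((d t) ^ 2).toReal with hYd
  set Yi : ℝ → ℝ := fun t => ν ^ (1 / 4 : ℝ) * ((i t) ^ 2).toReal with hYi
  have hY0 : ∀ t, 0 ≤ Y t := fun t => by positivity
  have hg0 : ∀ t, 0 ≤ Yd t + Yi t := fun t => by positivity
  have hdom : ∀ t, d t < ⊤ → i t < ⊤ → Y t ≤ Yd t + Yi t := by
    intro t hdt hit
    have hsq := eBesovSupSeminorm_sq_le_add (s := (1 / 2 : ℝ)) (p := (8 / 3 : ENNReal)) (v := u t) hν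
    have hfin : d t ^ 2 + i t ^ 2 ≠ ⊤ :=
      ENNReal.add_ne_top.2 ⟨ENNReal.pow_ne_top hdt.ne, ENNReal.pow_ne_top hit.ne⟩
    have hr := ENNReal.toReal_mono hfin hsq
    rw [ENNReal.toReal_add (ENNReal.pow_ne_top hdt.ne) (ENNReal.pow_ne_top hit.ne)] at hr
    simp only [hYdef, hYd, hYi]
    rw [← mul_add]
    exact mul_le_mul_of_nonneg_left hr (Real.rpow_nonneg hν.le _)
  refine ⟨?_, fun T hT => ?_, ⟨max (max T₁ T₂) 1, fun T hT => ?_⟩⟩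
  · filter_upwards [a1, a2] with t h1t h2t
    calc eBesovSupSeminorm (1 / 2 : ℝ) (8 / 3 : ENNReal) (u t) volume
        ≤ max (d t) (i t) := eBesovSupSeminorm_le_max_of_cover fun h _ => lags_cover hν h
      _ < ⊤ := max_lt h1t h2t
  · have hm : AEStronglyMeasurable Y (volume.restrict (Set.Ioc 0 T)) :=
      ((hS f hf ν hν u hu).mono_measure
        (Measure.restrict_mono (Set.Ioc_subset_Ioi_self : Set.Ioc (0 : ℝ) T ⊆ Set.Ioi 0) le_rfl)).const_mul _
    have haT : ∀ᵐ t ∂(volume.restrict (Set.Ioc 0 T)), d t < ⊤ ∧ i t < ⊤ :=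
      ae_restrict_of_ae_restrict_of_subset (Set.Ioc_subset_Ioi_self : Set.Ioc (0 : ℝ) T ⊆ Set.Ioi 0)
        (a1.and a2)
    refine Integrable.mono' ((b1 T hT).add (b2 T hT)) hm ?_
    filter_upwards [haT] with t ht
    rw [Real.norm_of_nonneg (hY0 t)]
    exact hdom t ht.1 ht.2
  · have hT1 : T₁ ≤ T := le_trans (le_trans (le_max_left _ _) (le_max_left _ _)) hT
    have hT2 : T₂ ≤ T := le_trans (le_trans (le_max_right _ _) (le_max_left _ _)) hT
    have hT0 : 0 < T := lt_of_lt_of_le one_pos (le_trans (le_max_right _ _) hT)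
    have haT : ∀ᵐ t ∂(volume.restrict (Set.Ioc 0 T)), d t < ⊤ ∧ i t < ⊤ :=
      ae_restrict_of_ae_restrict_of_subset (Set.Ioc_subset_Ioi_self : Set.Ioc (0 : ℝ) T ⊆ Set.Ioi 0)
        (a1.and a2)
    have hgi : IntegrableOn (fun t => Yd t + Yi t) (Set.Ioc 0 T) := (b1 T hT0).add (b2 T hT0)
    have hYg : timeMean Y T ≤ timeMean (fun t => Yd t + Yi t) T := by
      by_cases hYint : IntegrableOn Y (Set.Ioc 0 T)
      · unfold timeMean
        rw [intervalIntegral.integral_of_le hT0.le, intervalIntegral.integral_of_le hT0.le]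
        refine mul_le_mul_of_nonneg_left (integral_mono_ae hYint hgi ?_) (inv_nonneg.2 hT0.le)
        filter_upwards [haT] with t ht
        exact hdom t ht.1 ht.2
      · have h0 : timeMean Y T = 0 := by
          unfold timeMean
          rw [intervalIntegral.integral_of_le hT0.le, integral_undef hYint, mul_zero]
        rw [h0]
        exact timeMean_nonneg hg0 hT0.le
    calc timeMean Y T ≤ timeMean (fun t => Yd t + Yi t) T := hYg
      _ = timeMean Yd T + timeMean Yi T := timeMean_add hT0.le (b1 T hT0) (b2 T hT0)
      _ ≤ M₁ + M₂ := add_le_add (c1 T hT1) (c2 T hT2)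

end Glue

end Summit.AnomalousDissipation.AnomalousDissipation.Theorems.KolmogorovPincerLagCutGlue
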